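import Literature.Topology.FourManifolds.TautFoliationsLevelCircles
import Literature.Topology.FourManifolds.TautFoliationsFencePush
import Literature.Topology.FourManifolds.TautFoliationsFillFoliated
import Literature.Topology.PlanarFoliations.BandOpen
import HarnessLib

/-!
# The contour circles around a centre are image-null

Topic: the V-process inside the coned fence collar, ingredient (γ). For a disc in checkerboard
cone position, the contour lines of a roof (resp. floor) square at a level between the boundary
heights and the apex are compact leaves (`LevelCircles`); the filled disc map sends such a leaf
into ONE plaque of the box of the square (`fill_levelSet`), so its image loop is null-homotopic in
the leaf topology (`homotopic_refl_of_forall_mem_plaque`): **the points of these contour circles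
are image-null** (`imageNull_of_mem_levelSet`, `imageNull_of_mem_levelSet_floor`), and **every
open square contains an image-null point** (`exists_imageNull_mem_ball`: a level just below the
apex, above the maximum of the boundary heights).

* `imageNull_of_mem_levelSet`, `imageNull_of_mem_levelSet_floor`, `exists_imageNull_mem_ball`
  (**proved**).

All statements are [folklore].
-/

noncomputable section

open Set Filter Metric Topology Function Real
open Literature.Topology.PlanarFoliations

namespace Literature.Topology.FourManifolds

namespace Foliation.ConePosition

open SquareGrid SquareGrid.Grid ConeSquare

variable {B : Type*} [NormedAddCommGroup B] [NormedSpace ℝ B] {M : Type*} [TopologicalSpace M]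
  {F : Foliation B M} {f : ℝ × ℝ → M} {c₀ : ℝ × ℝ} {L : ℝ} {hL : 0 < L} (P : ConePosition F f c₀ hL)

/-- The image loop of a compact leaf running in one plaque of a box is null: the leaf is
image-null. [folklore] -/
theorem imageNull_of_leaf_subset (ho : F.IsTransverselyOriented) {y : P.gr.X₀} (hK : IsCompact ((P.contourFol ho).leaf y))
    {q : Fin P.n × Fin P.n} {h : ℝ} (hpl : ∀ z ∈ (P.contourFol ho).leaf y, P.fill P.apex (z : ℝ × ℝ) ∈ plaque (P.box q) h) :
    ImageNull (P.isFoliatedMap_fill ho) y := by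
  obtain ⟨γ, hc, hp, hinj, hsurj⟩ := exists_leafLoop_of_isCompact (x := y) (P.isBiOriented_contourFol ho) hK
  refine ⟨y, γ, hc, hp, (P.contourFol ho).mem_leaf_self y, hinj, hsurj, ?_⟩
  refine F.homotopic_refl_of_forall_mem_plaque (P.box_mem q) (t := h) _ fun θ ↦ ?_
  exact hpl _ (loopPath_mem_leaf γ hc hp θ)

/-- **The contour circles around a roof centre are image-null.** [folklore] -/
theorem imageNull_of_mem_levelSet (ho : F.IsTransverselyOriented) {q : Fin P.n × Fin P.n} {h : ℝ} (hr : (P.datum ho).roof q)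
    (hlo : ∀ y ∈ sphere (P.gr.centre q) P.gr.ℓ, (P.datum ho).ψ q y < h) (hhi : h < (P.datum ho).m q) {y : P.gr.X₀}
    (hy : (y : ℝ × ℝ) ∈ (P.datum ho).levelSet q h) : ImageNull (P.isFoliatedMap_fill ho) y := by
  have hleaf : (P.contourFol ho).leaf y = ((↑) : P.gr.X₀ → ℝ × ℝ) ⁻¹' (P.datum ho).levelSet q h := by
    rw [P.leaf_contourFol ho, (P.datum ho).leaf_eq_levelSet hr hlo hhi hy]
  have hK : IsCompact ((P.contourFol ho).leaf y) := by
    rw [P.leaf_contourFol ho]; exact (P.datum ho).isCompact_leaf_levelSet hr hlo hhi hy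
  refine P.imageNull_of_leaf_subset ho hK (q := q) (h := h) fun z hz ↦ ?_
  rw [hleaf] at hz
  exact P.fill_levelSet ho hz

/-- **The contour circles around a floor centre are image-null.** [folklore] -/
theorem imageNull_of_mem_levelSet_floor (ho : F.IsTransverselyOriented) {q : Fin P.n × Fin P.n} {h : ℝ} (hr : ¬ (P.datum ho).roof q)
    (hlo : (P.datum ho).m q < h) (hhi : ∀ y ∈ sphere (P.gr.centre q) P.gr.ℓ, h < (P.datum ho).ψ q y) {y : P.gr.X₀}
    (hy : (y : ℝ × ℝ) ∈ (P.datum ho).levelSet q h) : ImageNull (P.isFoliatedMap_fill ho) y := by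
  have hleaf : (P.contourFol ho).leaf y = ((↑) : P.gr.X₀ → ℝ × ℝ) ⁻¹' (P.datum ho).levelSet q h := by
    rw [P.leaf_contourFol ho, (P.datum ho).leaf_eq_levelSet_floor hr hlo hhi hy]
  have hK : IsCompact ((P.contourFol ho).leaf y) := by
    rw [P.leaf_contourFol ho]; exact (P.datum ho).isCompact_leaf_levelSet_floor hr hlo hhi hy
  refine P.imageNull_of_leaf_subset ho hK (q := q) (h := h) fun z hz ↦ ?_
  rw [hleaf] at hz
  exact P.fill_levelSet ho hz

/-- **Every open square contains an image-null point** (on a contour circle near the centre).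
[folklore] -/
theorem exists_imageNull_mem_ball (ho : F.IsTransverselyOriented) (q : Fin P.n × Fin P.n) :
    ∃ y : P.gr.X₀, (y : ℝ × ℝ) ∈ ball (P.gr.centre q) P.gr.ℓ ∧ ImageNull (P.isFoliatedMap_fill ho) y := by
  set D := P.datum ho with hD
  have hℓ := P.gr.hℓ
  have hsc : IsCompact (sphere (P.gr.centre q) P.gr.ℓ) := isCompact_sphere _ _
  have hsne : (sphere (P.gr.centre q) P.gr.ℓ).Nonempty := (P.gr.isConnected_sphere q).nonempty
  by_cases hr : D.roof q
  · -- a level above the maximum boundary height and below the apex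
    obtain ⟨y₁, hy₁, hmax⟩ := hsc.exists_isMaxOn hsne (D.cont q)
    set h := (D.ψ q y₁ + D.m q) / 2 with hh
    have h₁ : D.ψ q y₁ < D.m q := D.lt_apex q hr y₁ hy₁
    have hlo : ∀ y ∈ sphere (P.gr.centre q) P.gr.ℓ, D.ψ q y < h := fun y hy ↦ by
      have := hmax hy; simp only [mem_setOf_eq] at this; rw [hh]; linarith
    have hhi : h < D.m q := by rw [hh]; linarith
    -- a point of the (nonempty) contour line
    have hne : (D.levelSet q h).Nonempty := by
      rw [D.levelSet_eq_image hr hlo hhi]; exact hsne.image _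
    obtain ⟨x, hx⟩ := hne
    exact ⟨⟨x, D.levelSet_subset_X₀ hx⟩, hx.1, P.imageNull_of_mem_levelSet ho hr hlo hhi hx⟩
  · obtain ⟨y₁, hy₁, hmin⟩ := hsc.exists_isMinOn hsne (D.cont q)
    set h := (D.ψ q y₁ + D.m q) / 2 with hh
    have h₁ : D.m q < D.ψ q y₁ := D.apex_lt q hr y₁ hy₁
    have hhi : ∀ y ∈ sphere (P.gr.centre q) P.gr.ℓ, h < D.ψ q y := fun y hy ↦ by
      have := hmin hy; simp only [mem_setOf_eq] at this; rw [hh]; linarith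
    have hlo : D.m q < h := by rw [hh]; linarith
    have hne : (D.levelSet q h).Nonempty := by
      rw [D.levelSet_eq_image_floor hr hlo hhi]; exact hsne.image _
    obtain ⟨x, hx⟩ := hne
    exact ⟨⟨x, D.levelSet_subset_X₀ hx⟩, hx.1, P.imageNull_of_mem_levelSet_floor ho hr hlo hhi hx⟩

end Foliation.ConePosition

end Literature.Topology.FourManifolds
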